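/-
Copyright (c) 2026 the pub-hodgecm-mathlib formalisation cell (harness21).  Prover seat hodgecm-mathlib-LH4-p06 (g4), Track A «(D-RAM) FOUR-FRAME», unit U2H, the census leaf
(ρ2b′-X) — T5c «TORIC LEVEL CENSUS, M∕E-RAMIFIED»: the COUNTS (sequel of `QuadraticOrderLevelClassesRamified`; twin of LH4-p08 (g4)'s type-U counts).  2026-09-04.
-/
import Literature.NumberTheory.LocalFields.QuadraticOrderLevelClassesRamified   -- (this seat) §1–§3: twist, normal form `α^k·ω`, membership, generator sets → ★ F1 p857298, ★ p857299, ★ p857267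
import HarnessLib

/-!
# The u-free LEVEL COUNTS of the toric census when `M ∕ E` is RAMIFIED: `#levelSet(j,a) = [B : 𝒪_jˣ] − [B′ : 𝒪_jˣ]` (`a ≥ 1`), `= [B : 𝒪_jˣ]` (`a = 0`), `= 0` (no generator)
(Flicker 1998 p. 84 (Mars); Serre, *Local Fields* Ch. V §1–§3; Jacobowitz 1962 §4)

Topic `NumberTheory/LocalFields`; namespace `Literature.NumberTheory.LocalFields.QuadraticOrder`.  THEOREMS ONLY (no definition, no instance, no notation, no named fact, no `sorry`);
kernel lane `--supports stmt-HodgeConjecture-24833` (count-neutral).  Cell `pub/hodgecm-mathlib` (D-0151), crux H413, Track A «(D-RAM) FOUR-FRAME», unit U2H, leaf (ρ2b′-X):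
the T5c sheet's `levelSet j a` (★ DEFS p857239, M∕E ramified frame: conductor `ϖE^j`, `|ϖE| = exp(−2)`, M-uniformiser `α`) written out, counted through ★ F1
`ncard_setOf_orderLattice_eq_ncard_image_mk` (lattices ↔ cosets of `H = 𝒪_jˣ`), the prequel's generator sets `α^{k₀}·{…}` and ★ p857299's translation lemma at the class
`η′ := η·t(α^{k₀})` (`η = ρh∕h`) with a unit translator `η′·t(ω₀) = −1`:
* **`ncard_levelSetR_eq_relIndex_sub`** (`a ≥ 1`): `= H.relIndex B − H.relIndex B′`, `B ⊇ B′` the norm-depth subgroups at `exp(2a − 2j − d_ρ)` and one step below;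
* **`ncard_levelSetR_zero_eq_relIndex`** (`a = 0`): `= H.relIndex B`, `B` at `exp(−(2j + d_ρ))`;
* **`ncard_levelSetR_eq_zero_of_forall_ne`**: no solution `k` of `v_h + d_ρ + 2k + 2j = 2a` ⟹ `0`.
The index VALUES are ★ p857313 (`[𝒪_Mˣ : 𝒪_jˣ] = q^j`) and ★ p857338 (Θ-side, order-compatible `jK`); whether a translator EXISTS for the class `η·t(α^{k₀})` is F0P3-p01 (g32)'s
membership row `𝟙[u_s·ε^{k₀} ∈ H_c]` — a hypothesis here, discharged per cell type in the Theorems head (two class rows by the parity of `k₀`, RamM INDEX-LEMMAS §A).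
HONEST LABEL: HC_CM is proved only modulo the 7 printed citations (2 remaining named inputs: hLiu418 = stmt-HodgeConjecture-24832, h413 = stmt-HodgeConjecture-24833) until rung 0
closes; unconditional algebra, count-neutral (organ of the RamM census; no census value asserted).

## References
* [Flicker1998UnitaryFL] Y. Z. Flicker, *Elementary proof of the fundamental lemma for a unitary group*, Canad. J. Math. 50 (1998): p. 84 REMARK (Mars' orders and lattices `z·R_E(j)`).
* [Serre1979] J.-P. Serre, *Local Fields*, GTM 67 (1979): Ch. V §1, §3.
* [Jacobowitz1962] R. Jacobowitz, *Hermitian forms over local fields*, Amer. J. Math. 84 (1962): §4.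
-/

set_option autoImplicit false

open WithZero
open scoped Pointwise

namespace Literature.NumberTheory.LocalFields.QuadraticOrder

variable {K : Type*} [Field K] [Valued K ℤᵐ⁰] {ρ Θ : K →+* K} {α ϖE h : K} {dρ : ℕ}

/-- **THE COUNT, `a ≥ 1` (RamM)**: for the order units `H = 𝒪_jˣ`, the two norm-depth subgroups `B ⊇ B′` at depths `exp(2a − 2j − d_ρ)`, `exp(2a − 2j − d_ρ − 1)`, a unit translator
`ω₀` for the class `η·t(α^{k₀})` (`(η·t(α^{k₀}))·t(ω₀) = −1`, `v_h + d_ρ + 2k₀ + 2j = 2a`) and `H ≤ B′`: the order lattices of conductor `ϖE^j` with an integral Gram-primitive dual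
generator of level `|ϖE|^a` number **`[B : H] − [B′ : H]`** (`H.relIndex B − H.relIndex B′`; finiteness of the larger count as a binder).
[cite: Flicker1998UnitaryFL, p. 84] [cite: Serre1979, Ch. V §3] -/
theorem ncard_levelSetR_eq_relIndex_sub (hρρ : ∀ x, ρ (ρ x) = x) (hvρ : ∀ x, Valued.v (ρ x) = Valued.v x) (hvΘ : ∀ x, Valued.v (Θ x) = Valued.v x)
    (hfix : ∀ c : K, ρ c = c → c ≠ 0 → ∃ n : ℤ, Valued.v c = exp (2 * n)) (hρα : ρ α ≠ α)
    (hα : Valued.v α = exp (-1 : ℤ)) (hdρ : Valued.v (α - ρ α) = exp (-(dρ : ℤ))) (hϖE : Valued.v ϖE = exp (-2 : ℤ)) (hρϖ : ρ ϖE = ϖE)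
    (hh : h ≠ 0) {vh : ℤ} (hvh : Valued.v h = exp (-vh)) (j : ℕ) {a : ℕ} (ha : 1 ≤ a) {k₀ : ℤ} (hk₀ : vh + dρ + 2 * k₀ + 2 * j = 2 * a)
    {ω₀ : Kˣ} (hω₀ : Valued.v (ω₀ : K) = 1)
    (hη : (ρ h / h * (ρ (α ^ k₀ * Θ (α ^ k₀)) / (α ^ k₀ * Θ (α ^ k₀)))) * (ρ ((ω₀ : K) * Θ ω₀) / ((ω₀ : K) * Θ ω₀)) = -1)
    (H B B' : Subgroup Kˣ) (hH : ∀ u : Kˣ, u ∈ H ↔ Valued.v (u : K) = 1 ∧ Valued.v ((u : K) - ρ u) ≤ Valued.v (ϖE ^ j * (α - ρ α)))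
    (hB : ∀ ω : Kˣ, ω ∈ B ↔ Valued.v (ω : K) = 1 ∧ Valued.v ((ω : K) * Θ ω - ρ ((ω : K) * Θ ω)) ≤ exp (2 * (a : ℤ) - 2 * j - dρ))
    (hB' : ∀ ω : Kˣ, ω ∈ B' ↔ Valued.v (ω : K) = 1 ∧ Valued.v ((ω : K) * Θ ω - ρ ((ω : K) * Θ ω)) ≤ exp (2 * (a : ℤ) - 2 * j - dρ - 1))
    (hHB' : H ≤ B') (hfin : ((QuotientGroup.mk : Kˣ → Kˣ ⧸ H) '' (ω₀ • (B : Set Kˣ))).Finite) :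
    {Λ : AddSubgroup K | ∃ x₀ : K, x₀ ≠ 0 ∧ (∀ x, x ∈ Λ ↔ ∃ z, (Valued.v z ≤ 1 ∧ Valued.v (z - ρ z) ≤ Valued.v (ϖE ^ j * (α - ρ α))) ∧ x = x₀ * z) ∧
        (Valued.v (h * (x₀ * Θ x₀) * (ϖE ^ j * (α - ρ α))) ≤ 1 ∧
            Valued.v (h * (x₀ * Θ x₀) * (ϖE ^ j * (α - ρ α)) - ρ (h * (x₀ * Θ x₀) * (ϖE ^ j * (α - ρ α)))) ≤ Valued.v (ϖE ^ j * (α - ρ α))) ∧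
          ¬ (Valued.v (h * (x₀ * Θ x₀) * (ϖE ^ j * (α - ρ α)) / ϖE) ≤ 1 ∧
              Valued.v (h * (x₀ * Θ x₀) * (ϖE ^ j * (α - ρ α)) / ϖE - ρ (h * (x₀ * Θ x₀) * (ϖE ^ j * (α - ρ α)) / ϖE)) ≤ Valued.v (ϖE ^ j * (α - ρ α))) ∧
            Valued.v (h * (x₀ * Θ x₀) * (ϖE ^ j * (α - ρ α))) = Valued.v ϖE ^ a}.ncard =
      H.relIndex B - H.relIndex B' := by
  obtain ⟨hα0, -⟩ := ne_zero_and_v_zpow_of_v_eq hα 0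
  have hA := ncard_setOf_orderLattice_eq_ncard_image_mk hvρ hH (fun x₀ : Kˣ =>
    ((Valued.v (h * ((x₀ : K) * Θ x₀) * (ϖE ^ j * (α - ρ α))) ≤ 1 ∧
          Valued.v (h * ((x₀ : K) * Θ x₀) * (ϖE ^ j * (α - ρ α)) - ρ (h * ((x₀ : K) * Θ x₀) * (ϖE ^ j * (α - ρ α)))) ≤ Valued.v (ϖE ^ j * (α - ρ α))) ∧
        ¬ (Valued.v (h * ((x₀ : K) * Θ x₀) * (ϖE ^ j * (α - ρ α)) / ϖE) ≤ 1 ∧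
            Valued.v (h * ((x₀ : K) * Θ x₀) * (ϖE ^ j * (α - ρ α)) / ϖE - ρ (h * ((x₀ : K) * Θ x₀) * (ϖE ^ j * (α - ρ α)) / ϖE)) ≤ Valued.v (ϖE ^ j * (α - ρ α)))) ∧
      Valued.v (h * ((x₀ : K) * Θ x₀) * (ϖE ^ j * (α - ρ α))) = Valued.v ϖE ^ a)
  have hsets : {Λ : AddSubgroup K | ∃ x₀ : K, x₀ ≠ 0 ∧ (∀ x, x ∈ Λ ↔ ∃ z, (Valued.v z ≤ 1 ∧ Valued.v (z - ρ z) ≤ Valued.v (ϖE ^ j * (α - ρ α))) ∧ x = x₀ * z) ∧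
        (Valued.v (h * (x₀ * Θ x₀) * (ϖE ^ j * (α - ρ α))) ≤ 1 ∧
            Valued.v (h * (x₀ * Θ x₀) * (ϖE ^ j * (α - ρ α)) - ρ (h * (x₀ * Θ x₀) * (ϖE ^ j * (α - ρ α)))) ≤ Valued.v (ϖE ^ j * (α - ρ α))) ∧
          ¬ (Valued.v (h * (x₀ * Θ x₀) * (ϖE ^ j * (α - ρ α)) / ϖE) ≤ 1 ∧
              Valued.v (h * (x₀ * Θ x₀) * (ϖE ^ j * (α - ρ α)) / ϖE - ρ (h * (x₀ * Θ x₀) * (ϖE ^ j * (α - ρ α)) / ϖE)) ≤ Valued.v (ϖE ^ j * (α - ρ α))) ∧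
            Valued.v (h * (x₀ * Θ x₀) * (ϖE ^ j * (α - ρ α))) = Valued.v ϖE ^ a} =
      {Λ : AddSubgroup K | ∃ x₀ : Kˣ,
        (((Valued.v (h * ((x₀ : K) * Θ x₀) * (ϖE ^ j * (α - ρ α))) ≤ 1 ∧
          Valued.v (h * ((x₀ : K) * Θ x₀) * (ϖE ^ j * (α - ρ α)) - ρ (h * ((x₀ : K) * Θ x₀) * (ϖE ^ j * (α - ρ α)))) ≤ Valued.v (ϖE ^ j * (α - ρ α))) ∧
        ¬ (Valued.v (h * ((x₀ : K) * Θ x₀) * (ϖE ^ j * (α - ρ α)) / ϖE) ≤ 1 ∧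
            Valued.v (h * ((x₀ : K) * Θ x₀) * (ϖE ^ j * (α - ρ α)) / ϖE - ρ (h * ((x₀ : K) * Θ x₀) * (ϖE ^ j * (α - ρ α)) / ϖE)) ≤ Valued.v (ϖE ^ j * (α - ρ α)))) ∧
      Valued.v (h * ((x₀ : K) * Θ x₀) * (ϖE ^ j * (α - ρ α))) = Valued.v ϖE ^ a) ∧
        ∀ x, x ∈ Λ ↔ ∃ y, (Valued.v y ≤ 1 ∧ Valued.v (y - ρ y) ≤ Valued.v (ϖE ^ j * (α - ρ α))) ∧ x = (x₀ : K) * y} := by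
    ext Λ
    simp only [Set.mem_setOf_eq]
    constructor
    · rintro ⟨x₀, hx₀, hmem, hP1, hP2, hL⟩; exact ⟨Units.mk0 x₀ hx₀, ⟨⟨hP1, hP2⟩, hL⟩, hmem⟩
    · rintro ⟨x₀, ⟨⟨hP1, hP2⟩, hL⟩, hmem⟩; exact ⟨(x₀ : K), x₀.ne_zero, hmem, hP1, hP2, hL⟩
  rw [hsets, hA, setOf_levelGenR_eq_smul_of_pos hρρ hvΘ hfix hρα hα hdρ hϖE hρϖ hα0 hh hvh j ha hk₀, ncard_image_mk_smul, setOf_twistDepth_eq_diff,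
    setOf_v_one_add_mul_twist_le_eq_smul hvΘ hω₀ hη _ hB, setOf_v_one_add_mul_twist_le_eq_smul hvΘ hω₀ hη _ hB']
  rw [ncard_image_mk_diff H ?_ ?_ hfin, ncard_image_mk_smul_subgroup, ncard_image_mk_smul_subgroup]
  · -- `ω₀·B′ ⊆ ω₀·B`
    refine Set.smul_set_mono ?_
    intro ω hω
    obtain ⟨h1, h2⟩ := (hB' ω).1 hω
    exact (hB ω).2 ⟨h1, h2.trans (by rw [exp_le_exp]; omega)⟩
  · -- `ω₀·B′` is `H`-saturated
    intro x hx u hu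
    obtain ⟨b, hb, rfl⟩ := Set.mem_smul_set.1 hx
    refine Set.mem_smul_set.2 ⟨u * b, B'.mul_mem (hHB' hu) hb, ?_⟩
    simp only [smul_eq_mul]; rw [mul_left_comm]

/-- **THE COUNT, `a = 0` (RamM)**: with `v_h + d_ρ + 2k₀ + 2j = 0` and a unit translator for the class `η·t(α^{k₀})`, the level-`0` order lattices number `[B : H]`, `B` at depth
`exp(−(2j + d_ρ))`. [cite: Flicker1998UnitaryFL, p. 84] -/
theorem ncard_levelSetR_zero_eq_relIndex (hρρ : ∀ x, ρ (ρ x) = x) (hvρ : ∀ x, Valued.v (ρ x) = Valued.v x) (hvΘ : ∀ x, Valued.v (Θ x) = Valued.v x)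
    (hfix : ∀ c : K, ρ c = c → c ≠ 0 → ∃ n : ℤ, Valued.v c = exp (2 * n)) (hρα : ρ α ≠ α)
    (hα : Valued.v α = exp (-1 : ℤ)) (hdρ : Valued.v (α - ρ α) = exp (-(dρ : ℤ))) (hϖE : Valued.v ϖE = exp (-2 : ℤ)) (hρϖ : ρ ϖE = ϖE)
    (hh : h ≠ 0) {vh : ℤ} (hvh : Valued.v h = exp (-vh)) (j : ℕ) {k₀ : ℤ} (hk₀ : vh + dρ + 2 * k₀ + 2 * j = 0)
    {ω₀ : Kˣ} (hω₀ : Valued.v (ω₀ : K) = 1)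
    (hη : (ρ h / h * (ρ (α ^ k₀ * Θ (α ^ k₀)) / (α ^ k₀ * Θ (α ^ k₀)))) * (ρ ((ω₀ : K) * Θ ω₀) / ((ω₀ : K) * Θ ω₀)) = -1)
    (H B : Subgroup Kˣ) (hH : ∀ u : Kˣ, u ∈ H ↔ Valued.v (u : K) = 1 ∧ Valued.v ((u : K) - ρ u) ≤ Valued.v (ϖE ^ j * (α - ρ α)))
    (hB : ∀ ω : Kˣ, ω ∈ B ↔ Valued.v (ω : K) = 1 ∧ Valued.v ((ω : K) * Θ ω - ρ ((ω : K) * Θ ω)) ≤ exp (-(2 * (j : ℤ) + dρ))) :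
    {Λ : AddSubgroup K | ∃ x₀ : K, x₀ ≠ 0 ∧ (∀ x, x ∈ Λ ↔ ∃ z, (Valued.v z ≤ 1 ∧ Valued.v (z - ρ z) ≤ Valued.v (ϖE ^ j * (α - ρ α))) ∧ x = x₀ * z) ∧
        (Valued.v (h * (x₀ * Θ x₀) * (ϖE ^ j * (α - ρ α))) ≤ 1 ∧
            Valued.v (h * (x₀ * Θ x₀) * (ϖE ^ j * (α - ρ α)) - ρ (h * (x₀ * Θ x₀) * (ϖE ^ j * (α - ρ α)))) ≤ Valued.v (ϖE ^ j * (α - ρ α))) ∧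
          ¬ (Valued.v (h * (x₀ * Θ x₀) * (ϖE ^ j * (α - ρ α)) / ϖE) ≤ 1 ∧
              Valued.v (h * (x₀ * Θ x₀) * (ϖE ^ j * (α - ρ α)) / ϖE - ρ (h * (x₀ * Θ x₀) * (ϖE ^ j * (α - ρ α)) / ϖE)) ≤ Valued.v (ϖE ^ j * (α - ρ α))) ∧
            Valued.v (h * (x₀ * Θ x₀) * (ϖE ^ j * (α - ρ α))) = Valued.v ϖE ^ (0 : ℕ)}.ncard = H.relIndex B := by
  obtain ⟨hα0, -⟩ := ne_zero_and_v_zpow_of_v_eq hα 0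
  have hA := ncard_setOf_orderLattice_eq_ncard_image_mk hvρ hH (fun x₀ : Kˣ =>
    ((Valued.v (h * ((x₀ : K) * Θ x₀) * (ϖE ^ j * (α - ρ α))) ≤ 1 ∧
          Valued.v (h * ((x₀ : K) * Θ x₀) * (ϖE ^ j * (α - ρ α)) - ρ (h * ((x₀ : K) * Θ x₀) * (ϖE ^ j * (α - ρ α)))) ≤ Valued.v (ϖE ^ j * (α - ρ α))) ∧
        ¬ (Valued.v (h * ((x₀ : K) * Θ x₀) * (ϖE ^ j * (α - ρ α)) / ϖE) ≤ 1 ∧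
            Valued.v (h * ((x₀ : K) * Θ x₀) * (ϖE ^ j * (α - ρ α)) / ϖE - ρ (h * ((x₀ : K) * Θ x₀) * (ϖE ^ j * (α - ρ α)) / ϖE)) ≤ Valued.v (ϖE ^ j * (α - ρ α)))) ∧
      Valued.v (h * ((x₀ : K) * Θ x₀) * (ϖE ^ j * (α - ρ α))) = Valued.v ϖE ^ (0 : ℕ))
  have hsets : {Λ : AddSubgroup K | ∃ x₀ : K, x₀ ≠ 0 ∧ (∀ x, x ∈ Λ ↔ ∃ z, (Valued.v z ≤ 1 ∧ Valued.v (z - ρ z) ≤ Valued.v (ϖE ^ j * (α - ρ α))) ∧ x = x₀ * z) ∧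
        (Valued.v (h * (x₀ * Θ x₀) * (ϖE ^ j * (α - ρ α))) ≤ 1 ∧
            Valued.v (h * (x₀ * Θ x₀) * (ϖE ^ j * (α - ρ α)) - ρ (h * (x₀ * Θ x₀) * (ϖE ^ j * (α - ρ α)))) ≤ Valued.v (ϖE ^ j * (α - ρ α))) ∧
          ¬ (Valued.v (h * (x₀ * Θ x₀) * (ϖE ^ j * (α - ρ α)) / ϖE) ≤ 1 ∧
              Valued.v (h * (x₀ * Θ x₀) * (ϖE ^ j * (α - ρ α)) / ϖE - ρ (h * (x₀ * Θ x₀) * (ϖE ^ j * (α - ρ α)) / ϖE)) ≤ Valued.v (ϖE ^ j * (α - ρ α))) ∧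
            Valued.v (h * (x₀ * Θ x₀) * (ϖE ^ j * (α - ρ α))) = Valued.v ϖE ^ (0 : ℕ)} =
      {Λ : AddSubgroup K | ∃ x₀ : Kˣ,
        (((Valued.v (h * ((x₀ : K) * Θ x₀) * (ϖE ^ j * (α - ρ α))) ≤ 1 ∧
          Valued.v (h * ((x₀ : K) * Θ x₀) * (ϖE ^ j * (α - ρ α)) - ρ (h * ((x₀ : K) * Θ x₀) * (ϖE ^ j * (α - ρ α)))) ≤ Valued.v (ϖE ^ j * (α - ρ α))) ∧
        ¬ (Valued.v (h * ((x₀ : K) * Θ x₀) * (ϖE ^ j * (α - ρ α)) / ϖE) ≤ 1 ∧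
            Valued.v (h * ((x₀ : K) * Θ x₀) * (ϖE ^ j * (α - ρ α)) / ϖE - ρ (h * ((x₀ : K) * Θ x₀) * (ϖE ^ j * (α - ρ α)) / ϖE)) ≤ Valued.v (ϖE ^ j * (α - ρ α)))) ∧
      Valued.v (h * ((x₀ : K) * Θ x₀) * (ϖE ^ j * (α - ρ α))) = Valued.v ϖE ^ (0 : ℕ)) ∧
        ∀ x, x ∈ Λ ↔ ∃ y, (Valued.v y ≤ 1 ∧ Valued.v (y - ρ y) ≤ Valued.v (ϖE ^ j * (α - ρ α))) ∧ x = (x₀ : K) * y} := by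
    ext Λ
    simp only [Set.mem_setOf_eq]
    constructor
    · rintro ⟨x₀, hx₀, hmem, hP1, hP2, hL⟩; exact ⟨Units.mk0 x₀ hx₀, ⟨⟨hP1, hP2⟩, hL⟩, hmem⟩
    · rintro ⟨x₀, ⟨⟨hP1, hP2⟩, hL⟩, hmem⟩; exact ⟨(x₀ : K), x₀.ne_zero, hmem, hP1, hP2, hL⟩
  rw [hsets, hA, setOf_levelGenR_eq_smul_zero hρρ hvΘ hfix hρα hα hdρ hϖE hρϖ hα0 hh hvh j hk₀, ncard_image_mk_smul,
    setOf_v_one_add_mul_twist_le_eq_smul hvΘ hω₀ hη _ hB, ncard_image_mk_smul_subgroup]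

/-- **NO SOLUTION OF THE LEVEL EQUATION: THE COUNT IS `0`** (both sides; no translator needed). [cite: Flicker1998UnitaryFL, p. 84] -/
theorem ncard_levelSetR_eq_zero_of_forall_ne (hvρ : ∀ x, Valued.v (ρ x) = Valued.v x) (hvΘ : ∀ x, Valued.v (Θ x) = Valued.v x)
    (hα : Valued.v α = exp (-1 : ℤ)) (hdρ : Valued.v (α - ρ α) = exp (-(dρ : ℤ))) (hϖE : Valued.v ϖE = exp (-2 : ℤ)) {vh : ℤ} (hvh : Valued.v h = exp (-vh))
    (j a : ℕ) (hne : ∀ k : ℤ, vh + dρ + 2 * k + 2 * j ≠ 2 * a)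
    (H : Subgroup Kˣ) (hH : ∀ u : Kˣ, u ∈ H ↔ Valued.v (u : K) = 1 ∧ Valued.v ((u : K) - ρ u) ≤ Valued.v (ϖE ^ j * (α - ρ α))) :
    {Λ : AddSubgroup K | ∃ x₀ : K, x₀ ≠ 0 ∧ (∀ x, x ∈ Λ ↔ ∃ z, (Valued.v z ≤ 1 ∧ Valued.v (z - ρ z) ≤ Valued.v (ϖE ^ j * (α - ρ α))) ∧ x = x₀ * z) ∧
        (Valued.v (h * (x₀ * Θ x₀) * (ϖE ^ j * (α - ρ α))) ≤ 1 ∧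
            Valued.v (h * (x₀ * Θ x₀) * (ϖE ^ j * (α - ρ α)) - ρ (h * (x₀ * Θ x₀) * (ϖE ^ j * (α - ρ α)))) ≤ Valued.v (ϖE ^ j * (α - ρ α))) ∧
          ¬ (Valued.v (h * (x₀ * Θ x₀) * (ϖE ^ j * (α - ρ α)) / ϖE) ≤ 1 ∧
              Valued.v (h * (x₀ * Θ x₀) * (ϖE ^ j * (α - ρ α)) / ϖE - ρ (h * (x₀ * Θ x₀) * (ϖE ^ j * (α - ρ α)) / ϖE)) ≤ Valued.v (ϖE ^ j * (α - ρ α))) ∧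
            Valued.v (h * (x₀ * Θ x₀) * (ϖE ^ j * (α - ρ α))) = Valued.v ϖE ^ a}.ncard = 0 := by
  have hA := ncard_setOf_orderLattice_eq_ncard_image_mk hvρ hH (fun x₀ : Kˣ =>
    ((Valued.v (h * ((x₀ : K) * Θ x₀) * (ϖE ^ j * (α - ρ α))) ≤ 1 ∧
          Valued.v (h * ((x₀ : K) * Θ x₀) * (ϖE ^ j * (α - ρ α)) - ρ (h * ((x₀ : K) * Θ x₀) * (ϖE ^ j * (α - ρ α)))) ≤ Valued.v (ϖE ^ j * (α - ρ α))) ∧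
        ¬ (Valued.v (h * ((x₀ : K) * Θ x₀) * (ϖE ^ j * (α - ρ α)) / ϖE) ≤ 1 ∧
            Valued.v (h * ((x₀ : K) * Θ x₀) * (ϖE ^ j * (α - ρ α)) / ϖE - ρ (h * ((x₀ : K) * Θ x₀) * (ϖE ^ j * (α - ρ α)) / ϖE)) ≤ Valued.v (ϖE ^ j * (α - ρ α)))) ∧
      Valued.v (h * ((x₀ : K) * Θ x₀) * (ϖE ^ j * (α - ρ α))) = Valued.v ϖE ^ a)
  have hsets : {Λ : AddSubgroup K | ∃ x₀ : K, x₀ ≠ 0 ∧ (∀ x, x ∈ Λ ↔ ∃ z, (Valued.v z ≤ 1 ∧ Valued.v (z - ρ z) ≤ Valued.v (ϖE ^ j * (α - ρ α))) ∧ x = x₀ * z) ∧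
        (Valued.v (h * (x₀ * Θ x₀) * (ϖE ^ j * (α - ρ α))) ≤ 1 ∧
            Valued.v (h * (x₀ * Θ x₀) * (ϖE ^ j * (α - ρ α)) - ρ (h * (x₀ * Θ x₀) * (ϖE ^ j * (α - ρ α)))) ≤ Valued.v (ϖE ^ j * (α - ρ α))) ∧
          ¬ (Valued.v (h * (x₀ * Θ x₀) * (ϖE ^ j * (α - ρ α)) / ϖE) ≤ 1 ∧
              Valued.v (h * (x₀ * Θ x₀) * (ϖE ^ j * (α - ρ α)) / ϖE - ρ (h * (x₀ * Θ x₀) * (ϖE ^ j * (α - ρ α)) / ϖE)) ≤ Valued.v (ϖE ^ j * (α - ρ α))) ∧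
            Valued.v (h * (x₀ * Θ x₀) * (ϖE ^ j * (α - ρ α))) = Valued.v ϖE ^ a} =
      {Λ : AddSubgroup K | ∃ x₀ : Kˣ,
        (((Valued.v (h * ((x₀ : K) * Θ x₀) * (ϖE ^ j * (α - ρ α))) ≤ 1 ∧
          Valued.v (h * ((x₀ : K) * Θ x₀) * (ϖE ^ j * (α - ρ α)) - ρ (h * ((x₀ : K) * Θ x₀) * (ϖE ^ j * (α - ρ α)))) ≤ Valued.v (ϖE ^ j * (α - ρ α))) ∧
        ¬ (Valued.v (h * ((x₀ : K) * Θ x₀) * (ϖE ^ j * (α - ρ α)) / ϖE) ≤ 1 ∧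
            Valued.v (h * ((x₀ : K) * Θ x₀) * (ϖE ^ j * (α - ρ α)) / ϖE - ρ (h * ((x₀ : K) * Θ x₀) * (ϖE ^ j * (α - ρ α)) / ϖE)) ≤ Valued.v (ϖE ^ j * (α - ρ α)))) ∧
      Valued.v (h * ((x₀ : K) * Θ x₀) * (ϖE ^ j * (α - ρ α))) = Valued.v ϖE ^ a) ∧
        ∀ x, x ∈ Λ ↔ ∃ y, (Valued.v y ≤ 1 ∧ Valued.v (y - ρ y) ≤ Valued.v (ϖE ^ j * (α - ρ α))) ∧ x = (x₀ : K) * y} := by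
    ext Λ
    simp only [Set.mem_setOf_eq]
    constructor
    · rintro ⟨x₀, hx₀, hmem, hP1, hP2, hL⟩; exact ⟨Units.mk0 x₀ hx₀, ⟨⟨hP1, hP2⟩, hL⟩, hmem⟩
    · rintro ⟨x₀, ⟨⟨hP1, hP2⟩, hL⟩, hmem⟩; exact ⟨(x₀ : K), x₀.ne_zero, hmem, hP1, hP2, hL⟩
  rw [hsets, hA, setOf_levelGenR_eq_empty_of_forall_ne (ρ := ρ) (Θ := Θ) hvΘ hα hdρ hϖE hvh j a hne, Set.image_empty, Set.ncard_empty]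

end Literature.NumberTheory.LocalFields.QuadraticOrder
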